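import Summits.CriticalPhenomena.Ising3DConformalLimit.Theorems.PrecisionLaplacianMoebiusLimitOfTwoPointLawBoxClampedEM
import HarnessLib

/-!
# The conditional magnetisation given three spins has a nonpositive cubic coefficient

Tooth `stub_condCubicNonpos` of line `Sketch` (card `amputated-lebowitz-vertex-measure`) of crux
stmt-CriticalPhenomena-4801 `PrecisionLaplacian.MoebiusLimitOfTwoPointLaw`.

For the spin system `ν_{Λ;K}` (`Kᵢ ≥ 0` on supports of at most two sites; pair ferromagnet, possibly with
nonnegative fields) and sites `g, p, q, r`, with `Z_{st} = Z·ν(σ_p = 1, σ_q = s, σ_r = t)` and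
`N_{st} = Z·⟨σ_g ; σ_p = 1, σ_q = s, σ_r = t⟩`:

  `N_{++} Z_{--} Z_{+-} Z_{-+} + Z_{++} N_{--} Z_{+-} Z_{-+} ≤ Z_{++} Z_{--} N_{+-} Z_{-+} + Z_{++} Z_{--} Z_{+-} N_{-+}`,

i.e. `m(+,+,+) + m(+,-,-) ≤ m(+,+,-) + m(+,-,+)` for `m(s) = ⟨σ_g | (σ_p,σ_q,σ_r) = s⟩`. In zero field
(`m` odd) this is `κ ≤ 0` for the coefficient of `σ_pσ_qσ_r` in `⟨σ_g | σ_p, σ_q, σ_r⟩`, which is equivalent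
(exact identity, `Lines/Sketch-c17-structure.md`) to the four-site member `F4` of the line's conjecture VP¹
(`stub_amputatedLebowitz`): `⟨σ_gσ_pσ_qσ_r⟩ ≤ (⟨σ_gσ_p⟩,⟨σ_gσ_q⟩,⟨σ_gσ_r⟩) Σ_{pqr}⁻¹ (⟨σ_qσ_r⟩,⟨σ_pσ_r⟩,⟨σ_pσ_q⟩)ᵀ`.
Proof: the difference of the two sides is the box sum of `B_g w⁴` of the companion file
`…BoxClampedEM` (Ellis–Monroe expansion with three clamped sites), which is `≤ 0`.
-/

noncomputable section

namespace Summit.CriticalPhenomena.Ising3DConformalLimit.PrecisionLaplacianMoebiusLimitOfTwoPointLaw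

open Literature.Probability.LatticeModels Finset

section Split

variable {Λ : Type*} [Fintype Λ] [DecidableEq Λ]
variable {ι : Type*} (s : Finset ι) (K : ι → ℝ) (C : ι → Finset Λ)

/-- A sum over the four replicas of a product of four single-replica functions is the product of the
four single-replica sums. -/
theorem sum_cfg4_mul4 (f₁ f₂ f₃ f₄ : SpinConfig Λ → ℝ) :
    ∑ c : Cfg4 Λ, f₁ c.1 * f₂ c.2.1 * f₃ c.2.2.1 * f₄ c.2.2.2 =
      (∑ σ, f₁ σ) * (∑ σ, f₂ σ) * (∑ σ, f₃ σ) * (∑ σ, f₄ σ) := by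
  simp only [Fintype.sum_prod_type]
  simp only [← Finset.mul_sum, ← Finset.sum_mul]

/-- Splitting the box sum of an observable of the first replica into four restricted sums. -/
theorem sum_boxInd_mul_first (p q r : Λ) (F : SpinConfig Λ → ℝ) :
    ∑ c : Cfg4 Λ, boxInd p q r c * F c.1 * gksWeight4 s K C c =
      gksSum s K C (fun σ => clampInd p q r 1 1 σ * F σ) * gksSum s K C (clampInd p q r (-1) (-1)) *
        gksSum s K C (clampInd p q r 1 (-1)) * gksSum s K C (clampInd p q r (-1) 1) := by
  calc ∑ c : Cfg4 Λ, boxInd p q r c * F c.1 * gksWeight4 s K C c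
      = ∑ c : Cfg4 Λ, (clampInd p q r 1 1 c.1 * F c.1 * gksWeight s K C c.1) *
          (clampInd p q r (-1) (-1) c.2.1 * gksWeight s K C c.2.1) *
          (clampInd p q r 1 (-1) c.2.2.1 * gksWeight s K C c.2.2.1) *
          (clampInd p q r (-1) 1 c.2.2.2 * gksWeight s K C c.2.2.2) :=
        Finset.sum_congr rfl fun c _ => by simp only [boxInd, gksWeight4]; ring
    _ = _ := sum_cfg4_mul4 (fun σ => clampInd p q r 1 1 σ * F σ * gksWeight s K C σ)
          (fun σ => clampInd p q r (-1) (-1) σ * gksWeight s K C σ)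
          (fun σ => clampInd p q r 1 (-1) σ * gksWeight s K C σ)
          (fun σ => clampInd p q r (-1) 1 σ * gksWeight s K C σ)
    _ = _ := by simp only [gksSum]

/-- The same for an observable of the second replica. -/
theorem sum_boxInd_mul_second (p q r : Λ) (F : SpinConfig Λ → ℝ) :
    ∑ c : Cfg4 Λ, boxInd p q r c * F c.2.1 * gksWeight4 s K C c =
      gksSum s K C (clampInd p q r 1 1) * gksSum s K C (fun σ => clampInd p q r (-1) (-1) σ * F σ) *
        gksSum s K C (clampInd p q r 1 (-1)) * gksSum s K C (clampInd p q r (-1) 1) := by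
  calc ∑ c : Cfg4 Λ, boxInd p q r c * F c.2.1 * gksWeight4 s K C c
      = ∑ c : Cfg4 Λ, (clampInd p q r 1 1 c.1 * gksWeight s K C c.1) *
          (clampInd p q r (-1) (-1) c.2.1 * F c.2.1 * gksWeight s K C c.2.1) *
          (clampInd p q r 1 (-1) c.2.2.1 * gksWeight s K C c.2.2.1) *
          (clampInd p q r (-1) 1 c.2.2.2 * gksWeight s K C c.2.2.2) :=
        Finset.sum_congr rfl fun c _ => by simp only [boxInd, gksWeight4]; ring
    _ = _ := sum_cfg4_mul4 (fun σ => clampInd p q r 1 1 σ * gksWeight s K C σ)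
          (fun σ => clampInd p q r (-1) (-1) σ * F σ * gksWeight s K C σ)
          (fun σ => clampInd p q r 1 (-1) σ * gksWeight s K C σ)
          (fun σ => clampInd p q r (-1) 1 σ * gksWeight s K C σ)
    _ = _ := by simp only [gksSum]

/-- The same for an observable of the third replica. -/
theorem sum_boxInd_mul_third (p q r : Λ) (F : SpinConfig Λ → ℝ) :
    ∑ c : Cfg4 Λ, boxInd p q r c * F c.2.2.1 * gksWeight4 s K C c =
      gksSum s K C (clampInd p q r 1 1) * gksSum s K C (clampInd p q r (-1) (-1)) *
        gksSum s K C (fun σ => clampInd p q r 1 (-1) σ * F σ) * gksSum s K C (clampInd p q r (-1) 1) := by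
  calc ∑ c : Cfg4 Λ, boxInd p q r c * F c.2.2.1 * gksWeight4 s K C c
      = ∑ c : Cfg4 Λ, (clampInd p q r 1 1 c.1 * gksWeight s K C c.1) *
          (clampInd p q r (-1) (-1) c.2.1 * gksWeight s K C c.2.1) *
          (clampInd p q r 1 (-1) c.2.2.1 * F c.2.2.1 * gksWeight s K C c.2.2.1) *
          (clampInd p q r (-1) 1 c.2.2.2 * gksWeight s K C c.2.2.2) :=
        Finset.sum_congr rfl fun c _ => by simp only [boxInd, gksWeight4]; ring
    _ = _ := sum_cfg4_mul4 (fun σ => clampInd p q r 1 1 σ * gksWeight s K C σ)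
          (fun σ => clampInd p q r (-1) (-1) σ * gksWeight s K C σ)
          (fun σ => clampInd p q r 1 (-1) σ * F σ * gksWeight s K C σ)
          (fun σ => clampInd p q r (-1) 1 σ * gksWeight s K C σ)
    _ = _ := by simp only [gksSum]

/-- The same for an observable of the fourth replica. -/
theorem sum_boxInd_mul_fourth (p q r : Λ) (F : SpinConfig Λ → ℝ) :
    ∑ c : Cfg4 Λ, boxInd p q r c * F c.2.2.2 * gksWeight4 s K C c =
      gksSum s K C (clampInd p q r 1 1) * gksSum s K C (clampInd p q r (-1) (-1)) *
        gksSum s K C (clampInd p q r 1 (-1)) * gksSum s K C (fun σ => clampInd p q r (-1) 1 σ * F σ) := by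
  calc ∑ c : Cfg4 Λ, boxInd p q r c * F c.2.2.2 * gksWeight4 s K C c
      = ∑ c : Cfg4 Λ, (clampInd p q r 1 1 c.1 * gksWeight s K C c.1) *
          (clampInd p q r (-1) (-1) c.2.1 * gksWeight s K C c.2.1) *
          (clampInd p q r 1 (-1) c.2.2.1 * gksWeight s K C c.2.2.1) *
          (clampInd p q r (-1) 1 c.2.2.2 * F c.2.2.2 * gksWeight s K C c.2.2.2) :=
        Finset.sum_congr rfl fun c _ => by simp only [boxInd, gksWeight4]; ring
    _ = _ := sum_cfg4_mul4 (fun σ => clampInd p q r 1 1 σ * gksWeight s K C σ)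
          (fun σ => clampInd p q r (-1) (-1) σ * gksWeight s K C σ)
          (fun σ => clampInd p q r 1 (-1) σ * gksWeight s K C σ)
          (fun σ => clampInd p q r (-1) 1 σ * F σ * gksWeight s K C σ)
    _ = _ := by simp only [gksSum]

/-- **Restricted-sum form**: with `Z_{st} = ∑_σ 1[σ_p = 1, σ_q = s, σ_r = t] w(σ)` and
`N_{st} = ∑_σ 1[σ_p = 1, σ_q = s, σ_r = t] σ_g w(σ)`,
`N_{++}Z_{--}Z_{+-}Z_{-+} + Z_{++}N_{--}Z_{+-}Z_{-+} ≤ Z_{++}Z_{--}N_{+-}Z_{-+} + Z_{++}Z_{--}Z_{+-}N_{-+}`. -/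
theorem condCubic_gksSum (g p q r : Λ) (hK : ∀ i ∈ s, 0 ≤ K i) (hC : ∀ i ∈ s, (C i).card ≤ 2) :
    gksSum s K C (fun σ => clampInd p q r 1 1 σ * spinAt g σ) * gksSum s K C (clampInd p q r (-1) (-1)) *
        gksSum s K C (clampInd p q r 1 (-1)) * gksSum s K C (clampInd p q r (-1) 1) +
      gksSum s K C (clampInd p q r 1 1) * gksSum s K C (fun σ => clampInd p q r (-1) (-1) σ * spinAt g σ) *
        gksSum s K C (clampInd p q r 1 (-1)) * gksSum s K C (clampInd p q r (-1) 1) ≤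
    gksSum s K C (clampInd p q r 1 1) * gksSum s K C (clampInd p q r (-1) (-1)) *
        gksSum s K C (fun σ => clampInd p q r 1 (-1) σ * spinAt g σ) * gksSum s K C (clampInd p q r (-1) 1) +
      gksSum s K C (clampInd p q r 1 1) * gksSum s K C (clampInd p q r (-1) (-1)) *
        gksSum s K C (clampInd p q r 1 (-1)) * gksSum s K C (fun σ => clampInd p q r (-1) 1 σ * spinAt g σ) := by
  have h := sum_boxInd_mul_repB_mul_gksWeight4_nonpos s K C g p q r hK hC
  have e : ∑ c, boxInd p q r c * repB g c * gksWeight4 s K C c =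
      ∑ c : Cfg4 Λ, boxInd p q r c * spinAt g c.1 * gksWeight4 s K C c +
      ∑ c : Cfg4 Λ, boxInd p q r c * spinAt g c.2.1 * gksWeight4 s K C c -
      ∑ c : Cfg4 Λ, boxInd p q r c * spinAt g c.2.2.1 * gksWeight4 s K C c -
      ∑ c : Cfg4 Λ, boxInd p q r c * spinAt g c.2.2.2 * gksWeight4 s K C c := by
    rw [← Finset.sum_add_distrib, ← Finset.sum_sub_distrib, ← Finset.sum_sub_distrib]
    exact Finset.sum_congr rfl fun c _ => by simp only [repB]; ring
  rw [e, sum_boxInd_mul_first, sum_boxInd_mul_second, sum_boxInd_mul_third, sum_boxInd_mul_fourth] at h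
  linarith

end Split

/-! ### The field form (Box-GHS): the same expansion with replica-dependent fields instead of clamps

With fields `h ≥ 0` common to the four replicas (singleton interactions in `C`) and the extra fields
`(+b,+c)`, `(-b,-c)`, `(+b,-c)`, `(-b,+c)` at `(q, r)` on `(ξ, χ, ξ', χ')`, the product of the four Boltzmann
weights is `w⁴ · e^{b C_q} · e^{c (-D_r)}` (`C_q = ξ_q - χ_q + ξ'_q - χ'_q`, `-D_r = ξ_r - χ_r - ξ'_r + χ'_r`), a weight
that is again positive on the sign-twisted class; hence `∑ B_g w⁴ e^{bC_q} e^{-cD_r} ≤ 0`, i.e.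
`M(h+be_q+ce_r) + M(h-be_q-ce_r) ≤ M(h+be_q-ce_r) + M(h-be_q+ce_r)` for `M = ⟨σ_g⟩` — a box version of the
GHS inequality (GHS is its infinitesimal case `b, c → 0`); `stub_condCubicNonpos` is its clamped limit. -/

section BoxField

variable {Λ : Type*} [Fintype Λ] [DecidableEq Λ]

/-- The a-priori sum of a sign-twisted monomial is nonnegative (no clamping): the three sign symmetries
force equal parities of `(k, l, m, n)` at every site, and then the sign `(-1)^{l+n}` is `+1` sitewise. -/
theorem sum_signedRepMonomial_nonneg (k l m n : Λ → ℕ) :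
    0 ≤ ∑ c : Cfg4 Λ, signedRepMonomial k l m n c := by
  by_cases h1 : ∃ x, Odd (k x + l x + m x + n x)
  · obtain ⟨x, hodd⟩ := h1
    rw [sum_cfg4_eq_zero_of_odd (repNeg_involutive x) _ fun c => by
      rw [signedRepMonomial, repMonomial_repNeg, hodd.neg_one_pow, signedRepMonomial]; ring]
  by_cases h2 : ∃ x, Odd (m x + n x)
  · obtain ⟨x, hodd⟩ := h2
    rw [sum_cfg4_eq_zero_of_odd (repSwap₁_involutive x) _ fun c => by
      rw [signedRepMonomial, repMonomial_repSwap₁, hodd.neg_one_pow, signedRepMonomial]; ring]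
  by_cases h3 : ∃ x, Odd (l x + n x)
  · obtain ⟨x, hodd⟩ := h3
    rw [sum_cfg4_eq_zero_of_odd (repSwap₂_involutive x) _ fun c => by
      rw [signedRepMonomial, repMonomial_repSwap₂, hodd.neg_one_pow, signedRepMonomial]; ring]
  push Not at h1 h2 h3
  refine Finset.sum_nonneg fun c _ => ?_
  have hsign : ((-1 : ℝ)) ^ (∑ x, l x + ∑ x, n x) = ∏ x, (-1 : ℝ) ^ (l x + n x) := by
    rw [← Finset.sum_add_distrib, Finset.prod_pow_eq_pow_sum]
  rw [signedRepMonomial, hsign, repMonomial, ← Finset.prod_mul_distrib]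
  refine Finset.prod_nonneg fun x _ => ?_
  have e1 : Even (k x + l x + m x + n x) := Nat.not_odd_iff_even.1 (h1 x)
  have e2 : Even (m x + n x) := Nat.not_odd_iff_even.1 (h2 x)
  have e3 : Even (l x + n x) := Nat.not_odd_iff_even.1 (h3 x)
  rw [e3.neg_one_pow, one_mul]
  rcases Nat.even_or_odd (n x) with hn | hn
  · have hl : Even (l x) := by
      rcases Nat.even_or_odd (l x) with h' | h'
      · exact h'
      · exact absurd e3 (Nat.not_even_iff_odd.2 (h'.add_even hn))
    have hm : Even (m x) := by
      rcases Nat.even_or_odd (m x) with h' | h'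
      · exact h'
      · exact absurd e2 (Nat.not_even_iff_odd.2 (h'.add_even hn))
    have hk : Even (k x) := by
      rcases Nat.even_or_odd (k x) with h' | h'
      · exact h'
      · exact absurd e1 (Nat.not_even_iff_odd.2 (((h'.add_even hl).add_even hm).add_even hn))
    exact mul_nonneg (mul_nonneg (mul_nonneg (hk.pow_nonneg _) (hl.pow_nonneg _)) (hm.pow_nonneg _))
      (hn.pow_nonneg _)
  · have hl : Odd (l x) := by
      rcases Nat.even_or_odd (l x) with h' | h'
      · exact absurd e3 (Nat.not_even_iff_odd.2 (h'.add_odd hn))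
      · exact h'
    have hm : Odd (m x) := by
      rcases Nat.even_or_odd (m x) with h' | h'
      · exact absurd e2 (Nat.not_even_iff_odd.2 (h'.add_odd hn))
      · exact h'
    have hk : Odd (k x) := by
      rcases Nat.even_or_odd (k x) with h' | h'
      · exact absurd e1 (Nat.not_even_iff_odd.2 (((h'.add_odd hl).add_odd hm).add_odd hn))
      · exact h'
    obtain ⟨k', hk'⟩ := hk; obtain ⟨l', hl'⟩ := hl; obtain ⟨m', hm'⟩ := hm; obtain ⟨n', hn'⟩ := hn
    rw [hk', hl', hm', hn']
    have h := repA_mul_repB_mul_repC_mul_repD_nonneg x c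
    calc (0 : ℝ) ≤ (repA x c * repB x c * repC x c * repD x c) *
          ((repA x c ^ 2) ^ k' * (repB x c ^ 2) ^ l' * (repC x c ^ 2) ^ m' * (repD x c ^ 2) ^ n') :=
          mul_nonneg h (by positivity)
      _ = repA x c ^ (2 * k' + 1) * repB x c ^ (2 * l' + 1) * repC x c ^ (2 * m' + 1) *
          repD x c ^ (2 * n' + 1) := by ring

variable {ι : Type*} (s : Finset ι) (K : ι → ℝ) (C : ι → Finset Λ)

/-- The replicated weight times any weight that is positive on the twisted class stays positive on the
twisted class (Ellis–Monroe expansion, induction on the interaction set). -/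
theorem sum_signedRepClass_mul_gksWeight4_mul_nonneg {W : Cfg4 Λ → ℝ}
    (hW : ∀ M ∈ (signedRepClass : Set (Cfg4 Λ → ℝ)), 0 ≤ ∑ c, M c * W c)
    (hK : ∀ i ∈ s, 0 ≤ K i) (hC : ∀ i ∈ s, (C i).card ≤ 2) :
    ∀ M ∈ (signedRepClass : Set (Cfg4 Λ → ℝ)), 0 ≤ ∑ c, M c * (gksWeight4 s K C c * W c) := by
  classical
  have hmul := (signedRepClass_one_mem_mul_mem (Λ := Λ)).2
  have step : ∀ {Kc : ℝ}, 0 ≤ Kc → ∀ {A : Finset Λ}, A.card ≤ 2 → ∀ {W : Cfg4 Λ → ℝ},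
      (∀ M ∈ (signedRepClass : Set (Cfg4 Λ → ℝ)), 0 ≤ ∑ c, M c * W c) →
      ∀ M ∈ (signedRepClass : Set (Cfg4 Λ → ℝ)), 0 ≤ ∑ c, M c * (Real.exp (Kc * quadSum A c) * W c) := by
    intro Kc hKc A hA W hW
    have hcases : A.card = 0 ∨ A.card = 1 ∨ A.card = 2 := by omega
    rcases hcases with h0 | h1 | h2
    · rw [Finset.card_eq_zero] at h0
      subst h0
      intro M hM
      have h : ∑ c, M c * (Real.exp (Kc * quadSum ∅ c) * W c) = Real.exp (Kc * 4) * ∑ c, M c * W c := by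
        rw [Finset.mul_sum]
        refine Finset.sum_congr rfl fun c _ => ?_
        simp only [quadSum, spinProduct_empty]
        ring_nf
      rw [h]
      exact mul_nonneg (Real.exp_pos _).le (hW M hM)
    · obtain ⟨x, rfl⟩ := Finset.card_eq_one.1 h1
      simp_rw [quadSum_singleton]
      exact classExp_step hmul hW hKc (rep_mem_signedRepClass x).1
    · obtain ⟨x, y, hxy, rfl⟩ := Finset.card_eq_two.1 h2
      simp_rw [quadSum_pair hxy]
      intro M hM
      have h4 : (0 : ℝ) ≤ Kc * 4⁻¹ := by positivity
      obtain ⟨pA, pB, pC, pD⟩ := repPair_mem_signedRepClass (Λ := Λ) x y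
      have e1 := classExp_step hmul hW h4 pD
      have e2 := classExp_step hmul e1 h4 pC
      have e3 := classExp_step hmul e2 h4 pB
      have e4 := classExp_step hmul e3 h4 pA M hM
      have hexp : ∀ c : Cfg4 Λ, Real.exp (Kc * (4⁻¹ * (repA x c * repA y c) +
          4⁻¹ * (repB x c * repB y c) + 4⁻¹ * (repC x c * repC y c) + 4⁻¹ * (repD x c * repD y c))) * W c =
          Real.exp (Kc * 4⁻¹ * (repA x * repA y) c) * (Real.exp (Kc * 4⁻¹ * (repB x * repB y) c) *
            (Real.exp (Kc * 4⁻¹ * (repC x * repC y) c) *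
              (Real.exp (Kc * 4⁻¹ * (repD x * repD y) c) * W c))) := by
        intro c
        simp only [Pi.mul_apply]
        rw [show Kc * (4⁻¹ * (repA x c * repA y c) + 4⁻¹ * (repB x c * repB y c) +
            4⁻¹ * (repC x c * repC y c) + 4⁻¹ * (repD x c * repD y c)) =
            Kc * 4⁻¹ * (repA x c * repA y c) + (Kc * 4⁻¹ * (repB x c * repB y c) +
              (Kc * 4⁻¹ * (repC x c * repC y c) + Kc * 4⁻¹ * (repD x c * repD y c))) by ring,
          Real.exp_add, Real.exp_add, Real.exp_add]
        ring
      simp_rw [hexp]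
      exact e4
  simp_rw [gksWeight4_eq_exp]
  induction s using Finset.induction_on with
  | empty =>
    intro M hM
    simpa using hW M hM
  | insert j s hj ih =>
    have ih' := ih (fun i hi => hK i (Finset.mem_insert_of_mem hi))
      (fun i hi => hC i (Finset.mem_insert_of_mem hi))
    have h := step (hK j (Finset.mem_insert_self j s)) (hC j (Finset.mem_insert_self j s)) ih'
    intro M hM
    have hexp : ∀ c : Cfg4 Λ, Real.exp (∑ i ∈ insert j s, K i * quadSum (C i) c) * W c =
        Real.exp (K j * quadSum (C j) c) * (Real.exp (∑ i ∈ s, K i * quadSum (C i) c) * W c) := by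
      intro c
      rw [Finset.sum_insert hj, Real.exp_add, mul_assoc]
    simp_rw [hexp]
    exact h M hM

/-- **Box-GHS inequality, replica form.** For `Kᵢ ≥ 0` on supports of at most two sites (pair couplings and
nonnegative fields), sites `g q r` and `b, c ≥ 0`:
`∑_c B_g(c) w(ξ)w(χ)w(ξ')w(χ') e^{b C_q(c)} e^{-c D_r(c)} ≤ 0`, i.e., for the four replicas with the extra
fields `(+b,+c)`, `(-b,-c)`, `(+b,-c)`, `(-b,+c)` at `(q, r)`:
`M(h + b e_q + c e_r) + M(h - b e_q - c e_r) ≤ M(h + b e_q - c e_r) + M(h - b e_q + c e_r)` for the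
magnetisation `M = ⟨σ_g⟩`, `h ≥ 0` (its infinitesimal case is the GHS inequality). -/
theorem sum_repB_mul_gksWeight4_mul_exp_nonpos (g q r : Λ) {b c : ℝ} (hb : 0 ≤ b) (hc : 0 ≤ c)
    (hK : ∀ i ∈ s, 0 ≤ K i) (hC : ∀ i ∈ s, (C i).card ≤ 2) :
    ∑ x : Cfg4 Λ, repB g x * (gksWeight4 s K C x *
      (Real.exp (b * repC q x) * Real.exp (c * (-repD r) x))) ≤ 0 := by
  have hmul := (signedRepClass_one_mem_mul_mem (Λ := Λ)).2
  have h0 : ∀ M ∈ (signedRepClass : Set (Cfg4 Λ → ℝ)), 0 ≤ ∑ x, M x * (fun _ => (1 : ℝ)) x := by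
    rintro _ ⟨k, l, m, n, rfl⟩
    simpa using sum_signedRepMonomial_nonneg k l m n
  have h1 := classExp_step hmul h0 hc (rep_mem_signedRepClass r).2.2.2
  have h2 := classExp_step hmul h1 hb (rep_mem_signedRepClass q).2.1
  have h3 := sum_signedRepClass_mul_gksWeight4_mul_nonneg s K C h2 hK hC (-repB g) (rep_mem_signedRepClass g).2.2.1
  have e : ∑ x, (-repB g) x * (gksWeight4 s K C x * (Real.exp (b * repC q x) *
      (Real.exp (c * (-repD r) x) * (fun _ => (1 : ℝ)) x))) =
      -∑ x : Cfg4 Λ, repB g x * (gksWeight4 s K C x * (Real.exp (b * repC q x) * Real.exp (c * (-repD r) x))) := by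
    rw [← Finset.sum_neg_distrib]
    exact Finset.sum_congr rfl fun x _ => by simp only [Pi.neg_apply]; ring
  linarith [e ▸ h3]

end BoxField

/-- **Tooth `stub_condCubicNonpos` (the conditional magnetisation given three spins has a
nonpositive cubic coefficient; equivalently the four-site member `F4` of the VP¹ family).** For the
spin system `ν_{Λ;K}` on `Fin n` with couplings `Kᵢ ≥ 0` on supports `Cᵢ` of at most two sites and any
sites `g p q r`, in terms of the restricted sums
`Z_{st} = ∑_σ 1[σ_p = 1, σ_q = s, σ_r = t] w(σ)`, `N_{st} = ∑_σ 1[σ_p = 1, σ_q = s, σ_r = t] σ_g w(σ)`: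
`N_{++}Z_{--}Z_{+-}Z_{-+} + Z_{++}N_{--}Z_{+-}Z_{-+} ≤ Z_{++}Z_{--}N_{+-}Z_{-+} + Z_{++}Z_{--}Z_{+-}N_{-+}`,
i.e. `m(+,+,+) + m(+,-,-) ≤ m(+,+,-) + m(+,-,+)` for `m(s) = ⟨σ_g | (σ_p,σ_q,σ_r) = s⟩`. -/
theorem stub_condCubicNonpos :
    ∀ (n m : ℕ) (K : Fin m → ℝ) (C : Fin m → Finset (Fin n)), (∀ i, 0 ≤ K i) → (∀ i, (C i).card ≤ 2) →
      ∀ g p q r : Fin n,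
        gksSum Finset.univ K C (fun σ => (if spinAt p σ = 1 ∧ spinAt q σ = 1 ∧ spinAt r σ = 1 then 1 else 0) * spinAt g σ) *
            gksSum Finset.univ K C (fun σ => if spinAt p σ = 1 ∧ spinAt q σ = -1 ∧ spinAt r σ = -1 then 1 else 0) *
            gksSum Finset.univ K C (fun σ => if spinAt p σ = 1 ∧ spinAt q σ = 1 ∧ spinAt r σ = -1 then 1 else 0) *
            gksSum Finset.univ K C (fun σ => if spinAt p σ = 1 ∧ spinAt q σ = -1 ∧ spinAt r σ = 1 then 1 else 0) +
          gksSum Finset.univ K C (fun σ => if spinAt p σ = 1 ∧ spinAt q σ = 1 ∧ spinAt r σ = 1 then 1 else 0) *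
            gksSum Finset.univ K C (fun σ => (if spinAt p σ = 1 ∧ spinAt q σ = -1 ∧ spinAt r σ = -1 then 1 else 0) * spinAt g σ) *
            gksSum Finset.univ K C (fun σ => if spinAt p σ = 1 ∧ spinAt q σ = 1 ∧ spinAt r σ = -1 then 1 else 0) *
            gksSum Finset.univ K C (fun σ => if spinAt p σ = 1 ∧ spinAt q σ = -1 ∧ spinAt r σ = 1 then 1 else 0) ≤
        gksSum Finset.univ K C (fun σ => if spinAt p σ = 1 ∧ spinAt q σ = 1 ∧ spinAt r σ = 1 then 1 else 0) *
            gksSum Finset.univ K C (fun σ => if spinAt p σ = 1 ∧ spinAt q σ = -1 ∧ spinAt r σ = -1 then 1 else 0) *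
            gksSum Finset.univ K C (fun σ => (if spinAt p σ = 1 ∧ spinAt q σ = 1 ∧ spinAt r σ = -1 then 1 else 0) * spinAt g σ) *
            gksSum Finset.univ K C (fun σ => if spinAt p σ = 1 ∧ spinAt q σ = -1 ∧ spinAt r σ = 1 then 1 else 0) +
          gksSum Finset.univ K C (fun σ => if spinAt p σ = 1 ∧ spinAt q σ = 1 ∧ spinAt r σ = 1 then 1 else 0) *
            gksSum Finset.univ K C (fun σ => if spinAt p σ = 1 ∧ spinAt q σ = -1 ∧ spinAt r σ = -1 then 1 else 0) *
            gksSum Finset.univ K C (fun σ => if spinAt p σ = 1 ∧ spinAt q σ = 1 ∧ spinAt r σ = -1 then 1 else 0) *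
            gksSum Finset.univ K C (fun σ => (if spinAt p σ = 1 ∧ spinAt q σ = -1 ∧ spinAt r σ = 1 then 1 else 0) * spinAt g σ) := by
  intro n m K C hK hC g p q r
  exact condCubic_gksSum Finset.univ K C g p q r (fun i _ => hK i) (fun i _ => hC i)

end Summit.CriticalPhenomena.Ising3DConformalLimit.PrecisionLaplacianMoebiusLimitOfTwoPointLaw

end
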